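import Literature.NumberTheory.LFunctions.SuzukiScrewLine
import Literature.NumberTheory.LFunctions.WeilCriterionProofs
import Literature.Analysis.SpecialFunctions.DigammaGauss
import Literature.NumberTheory.LFunctions.LagariasXiStructureFunction
import Literature.NumberTheory.LFunctions.LiCoefficientsModelSpaceProofs
import Mathlib.Analysis.SpecialFunctions.ImproperIntegrals
import Literature.NumberTheory.LFunctions.RiemannXiLogDeriv
import Literature.NumberTheory.LFunctions.ZetaLogDerivDisc
import Literature.NumberTheory.LFunctions.ZetaLogDerivSeries
import Literature.NumberTheory.LFunctions.ZetaRealAxis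
import Literature.NumberTheory.LFunctions.RiemannSiegelFacts
import Literature.Analysis.SpecialFunctions.PolygammaSeries
import Literature.Analysis.SpecialFunctions.DigammaReflection
import HarnessLib
import Summits.RiemannHypothesis.RiemannHypothesis.Theorems.WeilPositivity

/-!
# Suzuki's screw line `𝔖_t` — PROOFS (discharges for `SuzukiScrewLine.lean`)

LINE 1 — LABEL: RH-FREE corpus theorems (kernel-checked consequences of the typed statements of
M. Suzuki, *On the Hilbert space derived from the Weil distribution*, Canad. J. Math. 2025 =
arXiv:2301.00421v3, and RH-free steps of its printed proofs). bears_on: B-C/B-P (COLUMN 6 DBR).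
WHAT THIS IS NOT: no statement about the truth of RH; the criteria fix WHICH identity would prove
RH through this door and do not move RH; nothing here bears on the truth of RH.

Contents (each item follows the printed argument at the cited lines):
* `Suzuki2025_thm45` — **CJM Thm 4.5** ("using (3.9), Theorem 1.4 is stated as follows": divide
  (1.9) by `π`), PROVED from the fact `Suzuki2025_thm14`; no separate named fact.
* `Suzuki2025_thm14_if` — the `⇐` direction of **CJM Thm 1.4** is RH-free given Weil's criterion:
  if `‖P̂_{Dψ}‖² = π⟨ψ,ψ⟩_W` for all `ψ ∈ C_c^∞(ℝ)` then `⟨ψ,ψ⟩_W ≥ 0` on `C_c^∞(ℝ)`, hence RH by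
  the tree's `weil_criterion_holds` (the paper's own route, §4.3: Weil negativity at an off-line
  zero). Kernel-checked: the door of this criterion is exactly Weil's.
* `Suzuki2025_cor43_mp_of_thm42` — the `⇒` half of **CJM Cor 4.3** from Thm 4.2: (4.4) at `u = t`
  and `G_g(t,t) = −2g(t) = 2Ψ(t)` give `(1/2π)‖𝔖_t‖² = −g(t)` for every `t` (so `t₀ = 0`).
* `screwLerchBracket_zero`, `screwP_zero`, `screwLine_zero` — **`𝔖_0 ≡ 0`** (proof of Thm 4.2,
  TeX l.1232–1240): at `t = 0` the Lerch bracket is `(Γ′/Γ)(¼) − (Γ′/Γ)(¼ − iz/2)` by the series (2.8)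
  (tree: `hasSum_one_div_sub_one_div_digamma`, for `Re(¼ − iz/2) > 0`, i.e. `Im z > −½`), and the
  two digamma brackets of (1.6) cancel.
* `hasWeilZeroSide_weilQuadratic` — the dictionary `⟨ψ,ψ⟩_W = W(ψ ∗ ψ̃)` of CJM (1.2) in the tree's
  words: the symmetric zero-side sum of `ψ ⋆ ψ̃` converges to `weilQuadratic ψ`
  (`explicit_formula_holds`).
* `Suzuki2025_prop41_eq41`, `Suzuki2025_prop41_eq42` — the "furthermore" clauses (4.1)
  `Θ′(γ)/2 = −i/m_γ` and (4.2) `F_γ(γ) = 1/√(m_γπ)`, `F_γ(γ′) = 0` of **CJM Prop 4.1**, in the typed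
  limit form, hold UNCONDITIONALLY (the printed proposition states them under RH): by
  `(1+Θ(z))/2 = ξ(s)/(ξ(s)+ξ′(s))` (`s = ½ − iz`) and the local expansion
  `ξ(s)/((ξ(s)+ξ′(s))(s−ρ)) → 1/m_ρ` ([Su23b] (2.9) = `Suzuki2023b_eq_s212_holds`), transported by
  `s − ρ = −i(z − γ)`. These are exactly the second and third conjuncts of `Suzuki2025_prop41`
  (which thus reduces to its orthonormal-basis clause).
* `memLp_two_one_add_theta_div`, `memLp_two_screwBasis` — **`F_γ|_ℝ ∈ L²(ℝ)` for every `γ ∈ Γ`,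
  UNCONDITIONALLY** (the `L²`-class `hF` presupposed by the typed Prop 4.1 and by the basis
  `ψ_γ = 𝖥⁻¹F_γ` of (5.11)): bounded near `γ` by the RH-free limit (4.1), `≤ 1/|x − γ|` elsewhere
  since `|Θ| ≤ 1` on `ℝ`, with the integrable majorant `C/(1 + (x − Re γ)²)`. (Appended by the cell's
  t10 seat; RH-FREE.)
* `Suzuki2025_thm71_eq71` — **CJM Thm 7.1 (7.1)** `lim_{z→0} 𝔓_t(z) = −g_ξ(t) = zetaScrew t` for every
  real `t` (the first conjunct of `Suzuki2025_thm71`), RH-FREE, PROVED: the termwise limits of (1.6) at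
  the regular point `0`, `ψ′(¼) = Σ(k+¼)^{-2}` (`ScrewValueAtZero.deriv_digamma_one_quarter`) and
  `ζ′/ζ(½) = ½(γ₀ + π/2 + 3 log 2 + log π)` (`ScrewValueAtZero.logDeriv_zeta_one_half`, from
  `ξ′(½) = 0` and Gauss's `ψ(¼)`). This is the formal check of the dictionary `g_ξ = −zetaScrew`.
  (The RH-free doors Cor 4.3 `⇐`, Thm 4.4 (i) `⇐` and the reductions `Suzuki2025_cor43_of_thm42`,
  `Suzuki2025_thm44_of_onlyIf` are in `SuzukiScrewLineDoorProofs.lean`, dbl-t6.)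
-/

noncomputable section

open MeasureTheory Complex Filter Set
open Literature.Analysis.DeBrangesSpaces (sharp)
open Literature.Analysis.SpecialFunctions.Complex (hasSum_one_div_sub_one_div_digamma
  hasSum_iteratedDeriv_digamma digamma_one_quarter_eq_neg_ofReal)
open scoped ComplexConjugate Topology

namespace Literature.NumberTheory.LFunctions

/-! ## Thm 4.5 from Thm 1.4 -/

/-- RH-EQUIVALENT (line 1; an `↔` conditional on the fact `Suzuki2025_thm14`): **CJM Thm 4.5** — the
RH is true if and only if `‖ψ‖₀² = ⟨ψ,ψ⟩_W` (4.11) for all `ψ ∈ C_c^∞(ℝ)`, where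
`‖ψ‖₀ = π^{−1/2}‖P̂_{Dψ}‖_{L²}` (3.9) (`screwNormZero`) and `⟨ψ,ψ⟩_W = weilQuadratic ψ`. Printed
derivation: "Using (3.9), Theorem 1.4 is stated as follows" — (1.9) divided by `π`.
[cite: Suzuki2025WeilHilbertSpace, Thm. 4.5 (TeX l.1385–1393)] -/
theorem Suzuki2025_thm45 (h : Suzuki2025_thm14) :
    RiemannHypothesis ↔ ∀ ψ : ℝ → ℂ, IsWeilTest ψ →
      ((screwNormZero ψ ^ 2 : ℝ) : ℂ) = weilQuadratic ψ := by
  have hπ : (Real.pi : ℂ) ≠ 0 := Complex.ofReal_ne_zero.mpr Real.pi_ne_zero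
  have key : ∀ ψ : ℝ → ℂ, (((screwNormZero ψ ^ 2 : ℝ) : ℂ) = weilQuadratic ψ) ↔
      (((∫ x : ℝ, ‖screwPhat (suzukiD ψ) x‖ ^ 2 : ℝ) : ℂ) = Real.pi * weilQuadratic ψ) := by
    intro ψ
    have hA : 0 ≤ ∫ x : ℝ, ‖screwPhat (suzukiD ψ) x‖ ^ 2 :=
      integral_nonneg fun _ ↦ by positivity
    have hsq : screwNormZero ψ ^ 2 = (∫ x : ℝ, ‖screwPhat (suzukiD ψ) x‖ ^ 2) / Real.pi := by
      unfold screwNormZero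
      rw [Real.sq_sqrt (div_nonneg hA Real.pi_pos.le)]
    rw [hsq, Complex.ofReal_div, div_eq_iff hπ, mul_comm]
  exact h.trans (forall_congr' fun ψ ↦ imp_congr_right fun _ ↦ (key ψ).symm)

/-! ## The RH-free direction of Thm 1.4 -/

/-- RH-FREE theorem: the `⇐` direction of **CJM Thm 1.4** (= arXiv:2209.04658 Cor 1.2, "via Weil's
criterion"). If `‖P̂_{Dψ}‖²_{L²(ℝ)} = π⟨ψ,ψ⟩_W` for every `ψ ∈ C_c^∞(ℝ)`, then
`⟨ψ,ψ⟩_W = ‖P̂_{Dψ}‖²/π ≥ 0` for every such `ψ`, i.e. Weil positivity, and the RH follows by Weil's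
criterion (`weil_criterion_holds`). [cite: Suzuki2025WeilHilbertSpace, Thm. 1.4 (⇐), §4.3 (TeX l.1303–1345)] -/
theorem Suzuki2025_thm14_if
    (h : ∀ ψ : ℝ → ℂ, IsWeilTest ψ →
      ((∫ x : ℝ, ‖screwPhat (suzukiD ψ) x‖ ^ 2 : ℝ) : ℂ) = Real.pi * weilQuadratic ψ) :
    RiemannHypothesis := by
  have hπ : (Real.pi : ℂ) ≠ 0 := Complex.ofReal_ne_zero.mpr Real.pi_ne_zero
  have hW : Summit.RiemannHypothesis.RiemannHypothesis.WeilPositivity := by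
    intro g hg
    have hq : weilQuadratic g =
        (((∫ x : ℝ, ‖screwPhat (suzukiD g) x‖ ^ 2) / Real.pi : ℝ) : ℂ) := by
      rw [Complex.ofReal_div, eq_div_iff hπ, mul_comm]
      exact (h g hg).symm
    rw [hq, Complex.ofReal_re]
    exact div_nonneg (integral_nonneg fun _ ↦ by positivity) Real.pi_pos.le
  exact (show RiemannHypothesis ↔ Summit.RiemannHypothesis.RiemannHypothesis.WeilPositivity from weil_criterion_holds).mpr hW

/-! ## Cor 4.3, the direction from Thm 4.2 -/

/-- RH-FREE reduction (the `⇒` half of **CJM Cor 4.3** from the fact `Suzuki2025_thm42`): under RH,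
(4.4) at `u = t` together with `G_g(t,t) = −2g(t)` (`zetaScrewKernel_self`: `= 2Ψ(t)`) gives
`(1/2π)‖𝔖_t‖²_{L²(ℝ)} = −g(t) = Ψ(t)` for every real `t` (in particular (4.6) with `t₀ = 0`).
[cite: Suzuki2025WeilHilbertSpace, Cor. 4.3 proof, first half (TeX l.1260–1263)] -/
theorem Suzuki2025_cor43_mp_of_thm42 (h42 : Suzuki2025_thm42) (hRH : RiemannHypothesis) (t : ℝ) :
    1 / (2 * Real.pi) * ∫ x : ℝ, ‖screwLine t x‖ ^ 2 = zetaScrew t := by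
  have h := (h42 hRH).1 t t
  rw [zetaScrewKernel_self] at h
  have hint : ∫ x : ℝ, screwLine t x * conj (screwLine t x) =
      ((∫ x : ℝ, ‖screwLine t x‖ ^ 2 : ℝ) : ℂ) := by
    rw [← integral_complex_ofReal]
    refine integral_congr_ae (Eventually.of_forall fun x ↦ ?_)
    simp only [Complex.mul_conj, Complex.normSq_eq_norm_sq, Complex.ofReal_pow]
  rw [hint] at h
  have h3 : 1 / Real.pi * ∫ x : ℝ, ‖screwLine t x‖ ^ 2 = 2 * zetaScrew t := by
    have h' : ((1 / Real.pi * ∫ x : ℝ, ‖screwLine t x‖ ^ 2 : ℝ) : ℂ) =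
        ((2 * zetaScrew t : ℝ) : ℂ) := by
      push_cast at h ⊢
      exact h
    exact_mod_cast h'
  calc 1 / (2 * Real.pi) * ∫ x : ℝ, ‖screwLine t x‖ ^ 2
      = (1 / Real.pi * ∫ x : ℝ, ‖screwLine t x‖ ^ 2) / 2 := by ring
    _ = zetaScrew t := by rw [h3]; ring

/-! ## `𝔖_0 ≡ 0` -/

/-- RH-FREE. At `t = 0` the Lerch bracket of (1.6) equals `(Γ′/Γ)(¼) − (Γ′/Γ)(¼ − iz/2)` for
`Im z > −½` (the series (2.8) `Γ′/Γ(w) = −γ₀ − Σ (1/(w+n) − 1/(n+1))`; tree: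
`hasSum_one_div_sub_one_div_digamma`). This is the limit the paper uses for `𝔖_0 ≡ 0`.
[cite: Suzuki2025WeilHilbertSpace, proof of Thm. 4.2 (TeX l.1232–1240)] -/
theorem screwLerchBracket_zero {z : ℂ} (hz : -1 / 2 < z.im) :
    screwLerchBracket 0 z = Complex.digamma (1 / 4) - Complex.digamma (1 / 4 - I * z / 2) := by
  unfold screwLerchBracket
  have ha : 0 < ((1 / 2 - I * z) / 2 : ℂ).re := by
    have : ((1 / 2 - I * z) / 2 : ℂ).re = (1 / 2 + z.im) / 2 := by
      simp [Complex.sub_re, Complex.mul_re]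
    rw [this]; linarith
  have h1 := hasSum_one_div_sub_one_div_digamma (w := (1 / 2 - I * z) / 2) ha
  have h2 := hasSum_one_div_sub_one_div_digamma (w := (1 / 4 : ℂ)) (by norm_num)
  have h3 := h2.sub h1
  have h4 : (fun n : ℕ ↦ (Real.exp (-(2 * |(0 : ℝ)| * n)) : ℂ) *
      (1 / ((n : ℂ) + (1 / 2 - I * z) / 2) - 1 / ((n : ℂ) + 1 / 4))) =
      fun k : ℕ ↦ (1 / ((k : ℂ) + 1) - 1 / (1 / 4 + k)) -
        (1 / ((k : ℂ) + 1) - 1 / ((1 / 2 - I * z) / 2 + k)) := by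
    funext k
    simp only [abs_zero, mul_zero, zero_mul, neg_zero, Real.exp_zero, Complex.ofReal_one, one_mul]
    ring
  rw [h4, h3.tsum_eq]
  have hw : ((1 / 2 - I * z) / 2 : ℂ) = 1 / 4 - I * z / 2 := by ring
  rw [hw]; ring

/-- RH-FREE. **`𝔓_0 ≡ 0`** on `Im z > −½` (all `t`-dependent terms of (1.6) vanish at `t = 0`,
`Λ(1) = 0`, and the two `Γ′/Γ` brackets cancel by `screwLerchBracket_zero`).
[cite: Suzuki2025WeilHilbertSpace, proof of Thm. 4.2 ("𝔖_0(z) is identically zero", TeX l.1232–1241)] -/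
theorem screwP_zero {z : ℂ} (hz : -1 / 2 < z.im) : screwP 0 z = 0 := by
  unfold screwP
  rw [screwLerchBracket_zero hz]
  have hfl : ⌊Real.exp |(0 : ℝ)|⌋₊ = 1 := by simp
  rw [hfl]
  simp [ArithmeticFunction.vonMangoldt_apply_one]
  ring

/-- RH-FREE. **`𝔖_0 ≡ 0`** on `Im z > −½` (in particular on the real line).
[cite: Suzuki2025WeilHilbertSpace, proof of Thm. 4.2 ("𝔖_0(z) is identically zero", TeX l.1232–1241)] -/
theorem screwLine_zero {z : ℂ} (hz : -1 / 2 < z.im) : screwLine 0 z = 0 := by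
  simp [screwLine, screwP_zero hz]

/-! ## Dictionary: `⟨ψ,ψ⟩_W = W(ψ ∗ ψ̃)` -/

/-- RH-FREE dictionary for CJM (1.2): for `ψ ∈ C_c^∞(ℝ)` the Weil distribution applied to `ψ ∗ ψ̃` —
the symmetric zero-side sum `lim_T Σ_{|Im ρ|≤T} m(ρ)(ψ ⋆ ψ̃)^(ρ)` (`W(φ) = Σ_γ m_γ φ̂(−γ)`,
`φ̂(−γ_ρ) = weilMellin φ ρ`) — converges to COLUMN 2's `weilQuadratic ψ` (explicit formula,
`explicit_formula_holds`). This is why `⟨ψ,ψ⟩_W` is typed as `weilQuadratic ψ` in `Suzuki2025_thm14`.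
[cite: Suzuki2025WeilHilbertSpace, eq. (1.2) (TeX l.146–152)] -/
theorem hasWeilZeroSide_weilQuadratic {ψ : ℝ → ℂ} (hψ : IsWeilTest ψ) :
    HasWeilZeroSide (weilConv ψ (weilReflect ψ)) (weilQuadratic ψ) :=
  explicit_formula_holds (hψ.weilConv hψ.weilReflect)

/-! ## Prop 4.1, clauses (4.1) and (4.2) — unconditionally -/

open ZetaZeros in
/-- The substitution `s = ½ − iz` maps punctured neighbourhoods of `γ` onto punctured neighbourhoods
of `½ − iγ`. [folklore] -/
private theorem tendsto_half_sub_I_mul_nhdsNE (γ : ℂ) :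
    Tendsto (fun z : ℂ ↦ 1 / 2 - I * z) (𝓝[≠] γ) (𝓝[≠] (1 / 2 - I * γ)) := by
  have hc : ContinuousWithinAt (fun z : ℂ ↦ 1 / 2 - I * z) ({γ}ᶜ) γ :=
    (Continuous.continuousWithinAt (by fun_prop))
  refine hc.tendsto_nhdsWithin fun z hz ↦ ?_
  intro h
  apply hz
  have h' : I * z = I * γ := by
    have := h
    simp only [Set.mem_singleton_iff] at this
    linear_combination -this
  exact mul_left_cancel₀ I_ne_zero h'

/-- Pointwise algebra behind `(1+Θ)/(2(z−γ)) = A/(E(z−γ))`: with `E = ξ + ξ′`, `E♯ = ξ − ξ′`,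
`s − ρ = −i(z−γ)`. [folklore] -/
private theorem one_add_theta_div_aux {ξ ξ' w : ℂ} (hE : ξ + ξ' ≠ 0) (hw : w ≠ 0) :
    -I * (ξ / ((ξ + ξ') * (-I * w))) = (1 + (ξ - ξ') / (ξ + ξ')) / (2 * w) := by
  have hI : (-I : ℂ) ≠ 0 := neg_ne_zero.2 I_ne_zero
  have hD : (ξ + ξ') * (-I * w) ≠ 0 := mul_ne_zero hE (mul_ne_zero hI hw)
  have hD' : (ξ + ξ') * (2 * w) ≠ 0 := mul_ne_zero hE (mul_ne_zero two_ne_zero hw)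
  rw [one_add_div hE, div_div, ← mul_div_assoc, div_eq_div_iff hD hD']
  ring

open ZetaZeros in
/-- RH-FREE · **CJM Prop 4.1, (4.1)** unconditionally: for every `γ ∈ Γ` (`γ = γ_ρ`, multiplicity
`m_γ = m(ρ)`), `lim_{z→γ, z≠γ} (1 + Θ_ξ(z))/(2(z − γ)) = −i/m_γ` — the printed "`Θ′(γ)/2 = −i/m_γ`"
(JNT 2023 proof of Prop 3.2: "`Θ′(γ)/2 = lim_{z→γ}(1+Θ(z))/(2(z−γ)) = −i/m_γ` by (2.9)"). Proof as
printed: `(1+Θ(z))/2 = A(z)/E(z) = ξ(s)/(ξ(s)+ξ′(s))` with `s = ½ − iz` (`sharp_lagariasE`), and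
`ξ(s)/((ξ(s)+ξ′(s))(s−ρ)) → 1/m_ρ` (`Suzuki2023b_eq_s212_holds`), `s − ρ = −i(z − γ)`. This is the
second conjunct of `Suzuki2025_prop41`, without the RH hypothesis.
[cite: Suzuki2025WeilHilbertSpace, Prop. 4.1 eq. (4.1) (TeX l.1124–1127); Suzuki2023b proof of Prop. 3.2] -/
theorem Suzuki2025_prop41_eq41 :
    ∀ ρ ∈ riemannZetaNontrivialZeros,
      Tendsto (fun z : ℂ ↦ (1 + lagariasTheta z) / (2 * (z - suzukiZeroParam ρ)))
        (𝓝[≠] suzukiZeroParam ρ) (𝓝 (-I / (riemannZetaZeroOrder ρ : ℂ))) := by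
  intro ρ hρ
  set γ := suzukiZeroParam ρ with hγ
  have haγ : (1 / 2 : ℂ) - I * γ = ρ := one_half_sub_I_mul_suzukiZeroParam ρ
  have hsub := tendsto_half_sub_I_mul_nhdsNE γ
  rw [haγ] at hsub
  have hg : Tendsto (fun z : ℂ ↦ riemannXi (1 / 2 - I * z) /
      ((riemannXi (1 / 2 - I * z) + deriv riemannXi (1 / 2 - I * z)) * ((1 / 2 - I * z) - ρ)))
      (𝓝[≠] γ) (𝓝 (1 / (riemannZetaZeroOrder ρ : ℂ))) :=
    (Suzuki2023b_eq_s212_holds ρ hρ).comp hsub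
  have hm0 : (1 / (riemannZetaZeroOrder ρ : ℂ)) ≠ 0 := by
    have h1 := riemannZetaNontrivialZeros.one_le_order hρ
    have : (riemannZetaZeroOrder ρ : ℂ) ≠ 0 := by exact_mod_cast (by omega : riemannZetaZeroOrder ρ ≠ 0)
    exact one_div_ne_zero this
  have hne := hg.eventually_ne hm0
  have hEq : (fun z : ℂ ↦ -I * (riemannXi (1 / 2 - I * z) /
      ((riemannXi (1 / 2 - I * z) + deriv riemannXi (1 / 2 - I * z)) * ((1 / 2 - I * z) - ρ))))
      =ᶠ[𝓝[≠] γ] fun z ↦ (1 + lagariasTheta z) / (2 * (z - γ)) := by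
    filter_upwards [hne, self_mem_nhdsWithin] with z hz hzγ
    have hE : riemannXi (1 / 2 - I * z) + deriv riemannXi (1 / 2 - I * z) ≠ 0 :=
      (mul_ne_zero_iff.mp (div_ne_zero_iff.mp hz).2).1
    have hsρ : (1 / 2 - I * z) - ρ = -I * (z - γ) := by rw [← haγ]; ring
    have hzγ' : z - γ ≠ 0 := sub_ne_zero.2 hzγ
    unfold lagariasTheta
    rw [sharp_lagariasE]
    unfold lagariasE at hE ⊢
    rw [hsρ]
    exact one_add_theta_div_aux hE hzγ'
  have hlim : Tendsto (fun z : ℂ ↦ -I * (riemannXi (1 / 2 - I * z) /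
      ((riemannXi (1 / 2 - I * z) + deriv riemannXi (1 / 2 - I * z)) * ((1 / 2 - I * z) - ρ))))
      (𝓝[≠] γ) (𝓝 (-I * (1 / (riemannZetaZeroOrder ρ : ℂ)))) := hg.const_mul (-I)
  have hval : -I * (1 / (riemannZetaZeroOrder ρ : ℂ)) = -I / (riemannZetaZeroOrder ρ : ℂ) := by ring
  rw [hval] at hlim
  exact hlim.congr' hEq

open ZetaZeros in
/-- RH-FREE · **CJM Prop 4.1, (4.2)** unconditionally: for `γ ∈ Γ`, `F_γ(z) → 1/√(m_γπ)` as `z → γ`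
and `F_γ(z) → 0` as `z → γ′` for every `γ′ ∈ Γ ∖ {γ}` (the printed values `F_γ(γ) = 1/√(m_γπ)`,
`F_γ(γ′) = 0` at the removable points), from (4.1): `F_γ = √(m_γ/π)·i·(1+Θ)/(2(z−γ))` and
`1 + Θ(z) → 0` at every `γ′ ∈ Γ`. Third conjunct of `Suzuki2025_prop41`, without the RH hypothesis.
[cite: Suzuki2025WeilHilbertSpace, Prop. 4.1 eq. (4.2) (TeX l.1128–1135)] -/
theorem Suzuki2025_prop41_eq42 :
    ∀ ρ ∈ riemannZetaNontrivialZeros,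
      Tendsto (screwBasis ρ) (𝓝[≠] suzukiZeroParam ρ)
          (𝓝 (((1 / Real.sqrt ((riemannZetaZeroOrder ρ : ℝ) * Real.pi) : ℝ) : ℂ))) ∧
        ∀ ρ' ∈ riemannZetaNontrivialZeros, ρ' ≠ ρ →
          Tendsto (screwBasis ρ) (𝓝[≠] suzukiZeroParam ρ') (𝓝 0) := by
  intro ρ hρ
  set γ := suzukiZeroParam ρ with hγ
  set c : ℝ := Real.sqrt ((riemannZetaZeroOrder ρ : ℝ) / Real.pi) with hc
  have hF : ∀ z : ℂ, screwBasis ρ z =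
      (c : ℂ) * I * ((1 + lagariasTheta z) / (2 * (z - γ))) := by
    intro z; unfold screwBasis; ring
  have hm1 := riemannZetaNontrivialZeros.one_le_order hρ
  have hmR : (0 : ℝ) < (riemannZetaZeroOrder ρ : ℝ) := by exact_mod_cast hm1
  refine ⟨?_, ?_⟩
  · -- value at `γ`
    have h := (Suzuki2025_prop41_eq41 ρ hρ).const_mul ((c : ℂ) * I)
    have hval : (c : ℂ) * I * (-I / (riemannZetaZeroOrder ρ : ℂ)) =
        (((1 / Real.sqrt ((riemannZetaZeroOrder ρ : ℝ) * Real.pi) : ℝ)) : ℂ) := by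
      have hI : (c : ℂ) * I * (-I / (riemannZetaZeroOrder ρ : ℂ)) =
          ((c / (riemannZetaZeroOrder ρ : ℝ) : ℝ) : ℂ) := by
        have hII : I * -I = (1 : ℂ) := by rw [mul_neg, I_mul_I, neg_neg]
        calc (c : ℂ) * I * (-I / (riemannZetaZeroOrder ρ : ℂ))
            = (c : ℂ) * (I * -I) / (riemannZetaZeroOrder ρ : ℂ) := by ring
          _ = (c : ℂ) / (riemannZetaZeroOrder ρ : ℂ) := by rw [hII, mul_one]
          _ = ((c / (riemannZetaZeroOrder ρ : ℝ) : ℝ) : ℂ) := by push_cast; rfl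
      rw [hI]
      congr 1
      have hsm : 0 < Real.sqrt (riemannZetaZeroOrder ρ : ℝ) := Real.sqrt_pos.2 hmR
      have hsπ : 0 < Real.sqrt Real.pi := Real.sqrt_pos.2 Real.pi_pos
      rw [hc, Real.sqrt_div' _ Real.pi_pos.le, Real.sqrt_mul hmR.le]
      field_simp
      rw [Real.sq_sqrt hmR.le]
    rw [hval] at h
    refine h.congr fun z ↦ ?_
    rw [hF]
  · intro ρ' hρ' hne
    set γ' := suzukiZeroParam ρ' with hγ'
    have hγne : γ' ≠ γ := fun h ↦ hne (suzukiZeroParam_injective h)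
    -- `1 + Θ(z) → 0` as `z → γ'`
    have h41 := Suzuki2025_prop41_eq41 ρ' hρ'
    rw [← hγ'] at h41
    have h2 : Tendsto (fun z : ℂ ↦ 2 * (z - γ')) (𝓝[≠] γ') (𝓝 0) := by
      have : Tendsto (fun z : ℂ ↦ 2 * (z - γ')) (𝓝 γ') (𝓝 (2 * (γ' - γ'))) :=
        (continuous_const.mul (continuous_id.sub continuous_const)).tendsto γ'
      rw [sub_self, mul_zero] at this
      exact this.mono_left nhdsWithin_le_nhds
    have h1 : Tendsto (fun z : ℂ ↦ 1 + lagariasTheta z) (𝓝[≠] γ') (𝓝 0) := by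
      have h3 := h41.mul h2
      rw [mul_zero] at h3
      refine h3.congr' ?_
      filter_upwards [self_mem_nhdsWithin] with z hz
      have hz' : z - γ' ≠ 0 := sub_ne_zero.2 hz
      field_simp
    -- the other factor is continuous at `γ'`
    have h4 : Tendsto (fun z : ℂ ↦ (c : ℂ) * I / (2 * (z - γ))) (𝓝[≠] γ')
        (𝓝 ((c : ℂ) * I / (2 * (γ' - γ)))) := by
      have hd : (2 : ℂ) * (γ' - γ) ≠ 0 := mul_ne_zero two_ne_zero (sub_ne_zero.2 hγne)
      have : ContinuousAt (fun z : ℂ ↦ (c : ℂ) * I / (2 * (z - γ))) γ' :=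
        continuousAt_const.div (by fun_prop) hd
      exact this.tendsto.mono_left nhdsWithin_le_nhds
    have h5 := h4.mul h1
    rw [mul_zero] at h5
    refine h5.congr fun z ↦ ?_
    rw [hF]
    ring

/-! ## Prop 4.1: the `L²(ℝ)`-class of `F_γ` — unconditionally -/

open ZetaZeros in
/-- The quotient `(1 + Θ_ξ(z))/(2(z − γ))` is square-integrable on the real line, for every `γ ∈ Γ`:
near `γ` it is bounded (it has the limit `−i/m_γ`, CJM (4.1), RH-free: `Suzuki2025_prop41_eq41`), and
away from `γ` it is `≤ 1/|x − γ|` since `|Θ_ξ| ≤ 1` on `ℝ`; hence the integrable majorant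
`C/(1 + (x − Re γ)²)` for its square. RH-FREE, PROVED (a step implicit in "F_γ ∈ 𝓚(Θ) ⊂ L²(ℝ)").
[cite: Suzuki2025WeilHilbertSpace, CJM Prop. 4.1 eq. (4.1) p. 10 (TeX l.1124–1127) and §3.2 p. 8 (TeX l.985–990: "|Θ(z)| = 1 for every z ∈ ℝ … 𝔖_t(z) is holomorphic there")] -/
theorem memLp_two_one_add_theta_div {ρ : ℂ} (hρ : ρ ∈ riemannZetaNontrivialZeros) :
    MemLp (fun x : ℝ ↦ (1 + lagariasTheta x) / (2 * ((x : ℂ) - suzukiZeroParam ρ))) 2 volume := by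
  set γ := suzukiZeroParam ρ with hγ
  set q : ℂ → ℂ := fun z ↦ (1 + lagariasTheta z) / (2 * (z - γ)) with hq_def
  -- (1) a bound near `γ`, from the limit (4.1)
  have hlim : Tendsto q (𝓝[≠] γ) (𝓝 (-I / (riemannZetaZeroOrder ρ : ℂ))) :=
    Suzuki2025_prop41_eq41 ρ hρ
  obtain ⟨δ, hδ, M, hM0, hM⟩ :
      ∃ δ > 0, ∃ M : ℝ, 0 ≤ M ∧ ∀ z : ℂ, z ≠ γ → dist z γ < δ → ‖q z‖ ≤ M := by
    have h1 : ∀ᶠ z in 𝓝[≠] γ, ‖q z‖ < ‖-I / (riemannZetaZeroOrder ρ : ℂ)‖ + 1 :=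
      hlim.norm.eventually (gt_mem_nhds (lt_add_one _))
    rw [eventually_nhdsWithin_iff, Metric.eventually_nhds_iff] at h1
    obtain ⟨δ, hδ, h⟩ := h1
    exact ⟨δ, hδ, ‖-I / (riemannZetaZeroOrder ρ : ℂ)‖ + 1, by positivity,
      fun z hz hd ↦ (h hd hz).le⟩
  -- (2) the bound away from `γ`: `‖q x‖ ≤ 1/‖x − γ‖` for real `x`
  have hfar : ∀ x : ℝ, ‖q x‖ ≤ ‖(x : ℂ) - γ‖⁻¹ := by
    intro x
    by_cases hx : (x : ℂ) - γ = 0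
    · simp [hq_def, hx]
    · have hpos : 0 < ‖(x : ℂ) - γ‖ := norm_pos_iff.2 hx
      rw [hq_def]
      simp only
      rw [norm_div, norm_mul, Complex.norm_two, div_le_iff₀ (by positivity)]
      calc ‖1 + lagariasTheta x‖ ≤ ‖(1 : ℂ)‖ + ‖lagariasTheta x‖ := norm_add_le _ _
        _ ≤ 1 + 1 := by rw [norm_one]; linarith [norm_lagariasTheta_ofReal_le_one x]
        _ = ‖(x : ℂ) - γ‖⁻¹ * (2 * ‖(x : ℂ) - γ‖) := by field_simp; norm_num
  -- (3) a global integrable majorant `C/(1 + (x − a)²)`, `a = Re γ`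
  set a : ℝ := γ.re with ha
  set C : ℝ := max (M ^ 2 * (1 + δ ^ 2)) (1 + δ⁻¹ ^ 2) with hC
  have hC0 : 0 ≤ C := le_max_of_le_right (by positivity)
  have hre : ∀ x : ℝ, |x - a| ≤ ‖(x : ℂ) - γ‖ := fun x ↦ by
    have := abs_re_le_norm ((x : ℂ) - γ)
    simpa [ha] using this
  have hbound : ∀ x : ℝ, ‖q x‖ ^ 2 ≤ C * (1 + (x - a) ^ 2)⁻¹ := by
    intro x
    have h1x : 0 < 1 + (x - a) ^ 2 := by positivity
    rw [← div_eq_mul_inv, le_div_iff₀ h1x]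
    by_cases hxγ : (x : ℂ) = γ
    · have : q x = 0 := by simp [hq_def, hxγ]
      rw [this, norm_zero]
      simpa using hC0
    by_cases hd : dist (x : ℂ) γ < δ
    · -- near γ
      have hqM : ‖q x‖ ^ 2 ≤ M ^ 2 := pow_le_pow_left₀ (norm_nonneg _) (hM _ hxγ hd) 2
      have hxa : (x - a) ^ 2 ≤ δ ^ 2 := by
        have h' : |x - a| < δ := (hre x).trans_lt (by rwa [dist_eq_norm] at hd)
        exact sq_le_sq' (by linarith [abs_lt.1 h' |>.1]) (abs_lt.1 h').2.le
      calc ‖q x‖ ^ 2 * (1 + (x - a) ^ 2) ≤ M ^ 2 * (1 + δ ^ 2) := by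
            gcongr
        _ ≤ C := le_max_left _ _
    · -- away from γ
      rw [not_lt, dist_eq_norm] at hd
      have hpos : 0 < ‖(x : ℂ) - γ‖ := hδ.trans_le hd
      have hq2 : ‖q x‖ ^ 2 ≤ (‖(x : ℂ) - γ‖ ^ 2)⁻¹ := by
        rw [← inv_pow]; exact pow_le_pow_left₀ (norm_nonneg _) (hfar x) 2
      have hxa : (x - a) ^ 2 ≤ ‖(x : ℂ) - γ‖ ^ 2 := by
        have := hre x
        rw [← sq_abs (x - a)]
        exact pow_le_pow_left₀ (abs_nonneg _) this 2
      have hone : (1 : ℝ) ≤ δ⁻¹ ^ 2 * ‖(x : ℂ) - γ‖ ^ 2 := by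
        rw [inv_pow, ← div_eq_inv_mul, one_le_div (by positivity)]
        exact pow_le_pow_left₀ hδ.le hd 2
      calc ‖q x‖ ^ 2 * (1 + (x - a) ^ 2)
          ≤ (‖(x : ℂ) - γ‖ ^ 2)⁻¹ * (δ⁻¹ ^ 2 * ‖(x : ℂ) - γ‖ ^ 2 + ‖(x : ℂ) - γ‖ ^ 2) := by
            gcongr
        _ = 1 + δ⁻¹ ^ 2 := by field_simp; ring
        _ ≤ C := le_max_right _ _
  -- (4) conclusion
  have hmeas : Measurable fun x : ℝ ↦ q x :=
    (measurable_const.add (measurable_lagariasTheta.comp Complex.measurable_ofReal)).div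
      (measurable_const.mul (Complex.measurable_ofReal.sub measurable_const))
  refine (memLp_two_iff_integrable_sq_norm hmeas.aestronglyMeasurable).2 ?_
  refine Integrable.mono' ((integrable_inv_one_add_sq.comp_sub_right a).const_mul C)
    (hmeas.norm.pow_const 2).aestronglyMeasurable (Eventually.of_forall fun x ↦ ?_)
  rw [Real.norm_of_nonneg (by positivity)]
  exact hbound x

open ZetaZeros in
/-- **`F_γ|_ℝ ∈ L²(ℝ)` for every `γ ∈ Γ`, UNCONDITIONALLY** (CJM Prop. 4.1 states, under RH, that
`(F_γ)_{γ∈Γ}` is an orthonormal basis of `𝓚(Θ) ⊂ L²(ℝ)`; the membership of each `F_γ` (3.5) in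
`L²(ℝ)` is RH-free: `F_γ = √(m_γ/π)·i·(1+Θ)/(2(z−γ))` is bounded near `γ` by (4.1) and
`≪ 1/|x − γ|` at infinity since `|Θ| ≤ 1` on `ℝ`). This is the `L²`-class `hF` presupposed by the
typed `Suzuki2025_prop41` and by the explicit basis `ψ_γ = 𝖥⁻¹F_γ` of (5.11). RH-FREE, PROVED.
[cite: Suzuki2025WeilHilbertSpace, CJM Prop. 4.1 p. 10 (TeX l.1120–1123: "F_γ … of 𝓚(Θ)") and eq. (3.5) (TeX l.1019–1025); Suzuki2023LiCoefficients Prop. 3.2] -/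
theorem memLp_two_screwBasis {ρ : ℂ} (hρ : ρ ∈ riemannZetaNontrivialZeros) :
    MemLp (fun x : ℝ ↦ screwBasis ρ x) 2 volume := by
  have h := (memLp_two_one_add_theta_div hρ).const_mul
    (((Real.sqrt ((riemannZetaZeroOrder ρ : ℝ) / Real.pi) : ℝ) : ℂ) * I)
  refine h.ae_eq (Eventually.of_forall fun x ↦ ?_)
  simp only [screwBasis]
  ring

/-! ## CJM Thm 7.1, (7.1): `𝔓_t(0) = −g_ξ(t) = Ψ(t)` — the value at the regular point `z = 0`

RH-FREE. The printed proof (TeX l.2131–2226) takes `z → 0` in (1.6) termwise: the elementary terms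
are continuous at `0`; `(e^{−izu} − 1)/(iz) → −u`; `ζ′/ζ(½ − iz) → ζ′/ζ(½)`;
`(ψ(¼ − iz/2) − ψ(¼))/(2iz) → −ψ′(¼)/4 = −¼Φ(1,2,¼)`; and
`e^{−t/2}B(t,z)/(2iz) → ¼e^{−t/2}Φ(e^{−2t},2,¼)` (the regularised series is continuous at `0`).
The constants are matched with the tree's `zetaScrew` (which spells `(Γ′/Γ)(¼) − log π` through
Gauss's digamma theorem) by `ζ′/ζ(½) = ½(γ₀ + π/2 + 3 log 2 + log π)`, a consequence of `ξ′(½) = 0`.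
(Appended by dbl-t7.) -/


namespace ScrewValueAtZero

/-- `ξ′(½) = 0` (functional equation `ξ(1−s) = ξ(s)`; local copy of
`ZetaScrewGrowth.deriv_riemannXi_one_half`, kept import-light). [cite: Titchmarsh1986, §2.1 (2.1.13)] -/
private theorem deriv_riemannXi_one_half : deriv riemannXi (1 / 2) = 0 := by
  have h : deriv (fun s ↦ riemannXi (1 - s)) (1 / 2 : ℂ) = -deriv riemannXi (1 - 1 / 2) :=
    deriv_comp_const_sub riemannXi 1 (1 / 2)
  have hfe : (fun s ↦ riemannXi (1 - s)) = riemannXi := funext riemannXi_one_sub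
  rw [hfe] at h
  norm_num at h
  linear_combination (1 / 2 : ℂ) * h

/-- `ζ(½) ≠ 0` (`ζ(σ) < 0` on `(0,1)`, `ZetaRealAxis`). [folklore] -/
private theorem zeta_half_ne_zero : riemannZeta (1 / 2) ≠ 0 := by
  have h := riemannZeta_neg_of_pos_of_lt_one (σ := 1 / 2) (by norm_num) (by norm_num)
  have h' : ((1 / 2 : ℝ) : ℂ) = 1 / 2 := by push_cast; ring
  rw [h'] at h
  intro h0
  rw [h0] at h
  simp at h

/-- **`ζ′/ζ(½) = ½(γ₀ + π/2 + 3 log 2 + log π)`** from `ξ′(½) = 0`, `ξ = (s/2)Γ_ℝ(s)(s−1)ζ(s)` and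
Gauss's `ψ(¼) = −γ₀ − π/2 − 3 log 2`. [cite: Suzuki2025WeilHilbertSpace, §7.1 (TeX l.2192–2226)] -/
theorem logDeriv_zeta_one_half :
    deriv riemannZeta (1 / 2) / riemannZeta (1 / 2) =
      ((Real.eulerMascheroniConstant + Real.pi / 2 + 3 * Real.log 2 + Real.log Real.pi) / 2 : ℝ) := by
  have hs1 : (1 / 2 : ℂ) ≠ 1 := by norm_num
  have hre : 0 < (1 / 2 : ℂ).re := by norm_num
  have hζ₁ : riemannZeta₁ (1 / 2) ≠ 0 := by
    rw [riemannZeta₁_eq_mul hs1]; exact mul_ne_zero (sub_ne_zero.2 hs1) zeta_half_ne_zero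
  have h1 := logDeriv_riemannZeta_eq hs1 zeta_half_ne_zero
  have h2 := logDeriv_riemannXi_eq hre hζ₁
  have h3 : logDeriv riemannXi (1 / 2) = 0 := by
    rw [logDeriv_apply, deriv_riemannXi_one_half, zero_div]
  have hpole : ∀ m : ℕ, (1 / 2 : ℂ) / 2 ≠ -m := by
    intro m h
    have := congrArg Complex.re h
    norm_num at this
    have hm : (0 : ℝ) ≤ m := m.cast_nonneg
    linarith
  have h4 : logDeriv Gammaℝ (1 / 2) = -(Complex.log Real.pi) / 2 + Complex.digamma (1 / 4) / 2 := by
    rw [logDeriv_Gammaℝ hpole]; norm_num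
  have h5 : logDeriv riemannZeta₁ (1 / 2) = -2 - logDeriv Gammaℝ (1 / 2) := by
    rw [h3] at h2
    have : (1 : ℂ) / (1 / 2) = 2 := by norm_num
    rw [this] at h2
    linear_combination -h2
  rw [← logDeriv_apply, h1, h5, h4, digamma_one_quarter_eq_neg_ofReal,
    ← Complex.ofReal_log Real.pi_pos.le]
  push_cast
  ring

/-- `ψ′(¼) = Σ_{k≥0} (k + ¼)^{-2}` (trigamma series). [cite: AndrewsAskeyRoy1999, Thm 1.2.5 (1.2.14)] -/
theorem deriv_digamma_one_quarter :
    deriv Complex.digamma (1 / 4) = ((∑' k : ℕ, 1 / ((k : ℝ) + 1 / 4) ^ 2 : ℝ) : ℂ) := by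
  have h := hasSum_iteratedDeriv_digamma (w := (1 / 4 : ℂ)) (by norm_num) (k := 1) le_rfl
  rw [iteratedDeriv_one] at h
  rw [Complex.ofReal_tsum, ← h.tsum_eq]
  refine tsum_congr fun k ↦ ?_
  push_cast
  ring

/-! ### The six limits as `z → 0` -/

/-- `(e^{−izu} − 1)/(iz) → −u`. [folklore] -/
private theorem tendsto_expFactor (u : ℝ) :
    Tendsto (fun z : ℂ ↦ (cexp (-(I * z * u)) - 1) / (I * z)) (𝓝[≠] 0) (𝓝 (-(u : ℂ))) := by
  have hd : HasDerivAt (fun z : ℂ ↦ cexp (-(I * z * u))) (-(I * u)) 0 := by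
    have h1 : HasDerivAt (fun z : ℂ ↦ -(I * z * u)) (-(I * 1 * u)) 0 :=
      (((hasDerivAt_id (0 : ℂ)).const_mul I).mul_const (u : ℂ)).neg
    have h2 := h1.cexp
    simp only [mul_zero, zero_mul, neg_zero, Complex.exp_zero, one_mul, mul_one] at h2
    exact h2
  have hs := hd.tendsto_slope_zero
  simp only [zero_add, mul_zero, zero_mul, neg_zero, Complex.exp_zero, smul_eq_mul] at hs
  have hs' := hs.const_mul (-I)
  have hlim : -I * -(I * (u : ℂ)) = -(u : ℂ) := by
    rw [neg_mul_neg, ← mul_assoc, Complex.I_mul_I]; ring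
  rw [hlim] at hs'
  refine hs'.congr' (eventually_nhdsWithin_of_forall fun z hz ↦ ?_)
  have hz' : (z : ℂ) ≠ 0 := hz
  field_simp
  ring_nf
  rw [Complex.I_sq]
  ring

/-- `c/(1 + 2iz) → c`. [folklore] -/
private theorem tendsto_const_div_add (c : ℂ) :
    Tendsto (fun z : ℂ ↦ c / (1 + 2 * I * z)) (𝓝[≠] 0) (𝓝 c) := by
  have hc : ContinuousAt (fun z : ℂ ↦ c / (1 + 2 * I * z)) 0 :=
    continuousAt_const.div (by fun_prop) (by simp)
  have h := hc.tendsto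
  simp only [mul_zero, add_zero, div_one] at h
  exact h.mono_left nhdsWithin_le_nhds

/-- `c/(1 − 2iz) → c`. [folklore] -/
private theorem tendsto_const_div_sub (c : ℂ) :
    Tendsto (fun z : ℂ ↦ c / (1 - 2 * I * z)) (𝓝[≠] 0) (𝓝 c) := by
  have hc : ContinuousAt (fun z : ℂ ↦ c / (1 - 2 * I * z)) 0 :=
    continuousAt_const.div (by fun_prop) (by simp)
  have h := hc.tendsto
  simp only [mul_zero, sub_zero, div_one] at h
  exact h.mono_left nhdsWithin_le_nhds

/-- `ζ′/ζ(½ − iz) → ζ′/ζ(½)`. [folklore] -/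
private theorem tendsto_logDerivZeta :
    Tendsto (fun z : ℂ ↦ deriv riemannZeta (1 / 2 - I * z) / riemannZeta (1 / 2 - I * z)) (𝓝[≠] 0)
      (𝓝 (deriv riemannZeta (1 / 2) / riemannZeta (1 / 2))) := by
  have hA : AnalyticAt ℂ riemannZeta (1 / 2) :=
    DifferentiableOn.analyticAt (s := {1}ᶜ)
      (fun s hs ↦ (differentiableAt_riemannZeta hs).differentiableWithinAt)
      (isOpen_compl_singleton.mem_nhds (by norm_num))
  have hq : ContinuousAt (fun s ↦ deriv riemannZeta s / riemannZeta s) (1 / 2) :=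
    hA.deriv.continuousAt.div hA.continuousAt zeta_half_ne_zero
  have hin : ContinuousAt (fun z : ℂ ↦ 1 / 2 - I * z) 0 := by fun_prop
  have hcomp : ContinuousAt ((fun s ↦ deriv riemannZeta s / riemannZeta s) ∘ (fun z : ℂ ↦ 1 / 2 - I * z)) 0 :=
    hq.comp_of_eq hin (by simp)
  have h := hcomp.tendsto
  simp only [Function.comp_def, mul_zero, sub_zero] at h
  exact h.mono_left nhdsWithin_le_nhds

/-- `(ψ(¼ − iz/2) − ψ(¼))/(2iz) → −ψ′(¼)/4`. [folklore] -/
private theorem tendsto_digammaTerm :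
    Tendsto (fun z : ℂ ↦ 1 / (2 * I * z) * (Complex.digamma (1 / 4 - I * z / 2) - Complex.digamma (1 / 4)))
      (𝓝[≠] 0) (𝓝 (-(deriv Complex.digamma (1 / 4)) / 4)) := by
  have hψ : HasDerivAt Complex.digamma (deriv Complex.digamma (1 / 4)) (1 / 4) :=
    (Literature.NumberTheory.LFunctions.analyticAt_digamma_of_re_pos
      (by norm_num : 0 < (1 / 4 : ℂ).re)).differentiableAt.hasDerivAt
  have hin : HasDerivAt (fun z : ℂ ↦ 1 / 4 - I * z / 2) (-(I / 2)) 0 := by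
    have := (((hasDerivAt_id (0 : ℂ)).const_mul I).div_const 2).const_sub (1 / 4 : ℂ)
    simpa [mul_one, neg_div] using this
  have hψ' : HasDerivAt Complex.digamma (deriv Complex.digamma (1 / 4))
      ((fun z : ℂ ↦ 1 / 4 - I * z / 2) 0) := by
    simpa only [mul_zero, zero_div, sub_zero] using hψ
  have hg := hψ'.comp 0 hin
  have hs := hg.tendsto_slope_zero
  simp only [zero_add, Function.comp_def, mul_zero, zero_div, sub_zero, smul_eq_mul] at hs
  have hs' := hs.const_mul (1 / (2 * I))
  have hlim : 1 / (2 * I) * (deriv Complex.digamma (1 / 4) * -(I / 2)) =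
      -(deriv Complex.digamma (1 / 4)) / 4 := by
    have hII : I * (1 / (2 * I)) = 1 / 2 := by
      rw [mul_one_div, mul_comm (2 : ℂ) I, ← div_div, div_self Complex.I_ne_zero]
    calc 1 / (2 * I) * (deriv Complex.digamma (1 / 4) * -(I / 2))
        = -(deriv Complex.digamma (1 / 4) * (I * (1 / (2 * I)))) / 2 := by ring
      _ = -(deriv Complex.digamma (1 / 4)) / 4 := by rw [hII]; ring
  rw [hlim] at hs'
  refine hs'.congr' (eventually_nhdsWithin_of_forall fun z hz ↦ ?_)
  have hz' : (z : ℂ) ≠ 0 := hz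
  field_simp

/-- The `n`-th term of `B(t,z)/(2iz)` for `z ≠ 0` in the disc `|z| < ½`. [folklore] -/
private theorem lerchTerm_div_eq (t : ℝ) {z : ℂ} (hz : z ≠ 0) (hz' : ‖z‖ < 1 / 2) (n : ℕ) :
    (Real.exp (-(2 * |t| * n)) : ℂ) * (1 / ((n : ℂ) + (1 / 2 - I * z) / 2) - 1 / ((n : ℂ) + 1 / 4)) *
        (1 / (2 * I * z)) =
      (Real.exp (-(2 * |t| * n)) : ℂ) * (1 / 4 / (((n : ℂ) + (1 / 2 - I * z) / 2) * ((n : ℂ) + 1 / 4))) := by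
  have hk : (0 : ℝ) ≤ n := n.cast_nonneg
  have hq : ((n : ℂ) + 1 / 4) ≠ 0 := by
    intro h; have := congrArg Complex.re h; simp at this; linarith
  have hw : ((n : ℂ) + (1 / 2 - I * z) / 2) ≠ 0 := by
    intro h
    have hre := congrArg Complex.re h
    have e1 : ((n : ℂ) + (1 / 2 - I * z) / 2).re = n + 1 / 4 + z.im / 2 := by simp; ring
    rw [e1, Complex.zero_re] at hre
    have him : |z.im| ≤ ‖z‖ := Complex.abs_im_le_norm z
    have : -(1 / 2) < z.im := by linarith [neg_abs_le z.im]
    linarith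
  have hIz : I * z ≠ 0 := mul_ne_zero Complex.I_ne_zero hz
  have h14 : I * z / 2 * (1 / (2 * I * z)) = 1 / 4 := by
    field_simp
    ring
  rw [div_sub_div _ _ hw hq]
  have hnum : (1 * ((n : ℂ) + 1 / 4) - ((n : ℂ) + (1 / 2 - I * z) / 2) * 1) = I * z / 2 := by ring
  rw [hnum]
  rw [show (Real.exp (-(2 * |t| * n)) : ℂ) * (I * z / 2 / (((n : ℂ) + (1 / 2 - I * z) / 2) * ((n : ℂ) + 1 / 4))) *
      (1 / (2 * I * z)) = (Real.exp (-(2 * |t| * n)) : ℂ) * ((I * z / 2 * (1 / (2 * I * z))) /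
        (((n : ℂ) + (1 / 2 - I * z) / 2) * ((n : ℂ) + 1 / 4))) by ring, h14]

/-- `B(t,z)/(2iz) → ¼ Σ e^{−2|t|n}(n+¼)^{-2}`. [folklore] -/
private theorem tendsto_lerchTerm (t : ℝ) :
    Tendsto (fun z : ℂ ↦ 1 / (2 * I * z) * ((Real.exp (-(|t| / 2)) : ℝ) : ℂ) * screwLerchBracket t z)
      (𝓝[≠] 0)
      (𝓝 (((Real.exp (-(|t| / 2)) : ℝ) : ℂ) *
        ∑' n : ℕ, (Real.exp (-(2 * |t| * n)) : ℂ) * (1 / 4 / (((n : ℂ) + 1 / 4) * ((n : ℂ) + 1 / 4))))) := by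
  -- the regularised series `h n z = e^{-2|t|n} (1/4)/((n + ¼ − iz/2)(n + ¼))`
  have hden : ∀ n : ℕ, ∀ z : ℂ, ‖z‖ < 1 / 4 → (n : ℝ) + 1 / 8 ≤ ‖(n : ℂ) + (1 / 2 - I * z) / 2‖ := by
    intro n z hz
    have hre := Complex.abs_re_le_norm ((n : ℂ) + (1 / 2 - I * z) / 2)
    have e1 : ((n : ℂ) + (1 / 2 - I * z) / 2).re = n + 1 / 4 + z.im / 2 := by
      simp; ring
    rw [e1] at hre
    have him : |z.im| ≤ ‖z‖ := Complex.abs_im_le_norm z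
    have : -(1 / 4) ≤ z.im := by linarith [neg_abs_le z.im]
    have hk : (0 : ℝ) ≤ n := n.cast_nonneg
    rw [abs_of_pos (by linarith)] at hre
    linarith
  have hcont : ∀ n : ℕ, ContinuousOn (fun z : ℂ ↦ (Real.exp (-(2 * |t| * n)) : ℂ) *
      (1 / 4 / (((n : ℂ) + (1 / 2 - I * z) / 2) * ((n : ℂ) + 1 / 4)))) (Metric.ball 0 (1 / 4)) := by
    intro n
    have hne : ∀ z ∈ Metric.ball (0 : ℂ) (1 / 4),
        ((n : ℂ) + (1 / 2 - I * z) / 2) * ((n : ℂ) + 1 / 4) ≠ 0 := by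
      intro z hz
      rw [Metric.mem_ball, dist_zero_right] at hz
      have h1 := hden n z hz
      have hk : (0 : ℝ) ≤ n := n.cast_nonneg
      refine mul_ne_zero ?_ ?_
      · intro h0; rw [h0, norm_zero] at h1; linarith
      · intro h0; have := congrArg Complex.re h0; simp at this; linarith
    exact continuousOn_const.mul (continuousOn_const.div (by fun_prop) hne)
  have hsum : Summable (fun n : ℕ ↦ (16 : ℝ) / ((n : ℝ) + 1) ^ 2) := by
    have h1 : Summable (fun n : ℕ ↦ 1 / ((n + 1 : ℕ) : ℝ) ^ 2) :=
      (summable_nat_add_iff 1).mpr (Real.summable_one_div_nat_pow.mpr one_lt_two)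
    simpa [div_eq_mul_inv] using h1.mul_left 16
  have hbound : ∀ (n : ℕ) (z : ℂ), z ∈ Metric.ball (0 : ℂ) (1 / 4) →
      ‖(Real.exp (-(2 * |t| * n)) : ℂ) * (1 / 4 / (((n : ℂ) + (1 / 2 - I * z) / 2) * ((n : ℂ) + 1 / 4)))‖ ≤
        16 / ((n : ℝ) + 1) ^ 2 := by
    intro n z hz
    rw [Metric.mem_ball, dist_zero_right] at hz
    have hk : (0 : ℝ) ≤ n := n.cast_nonneg
    have h1 := hden n z hz
    have hexp : ‖(Real.exp (-(2 * |t| * n)) : ℂ)‖ ≤ 1 := by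
      rw [Complex.norm_real, Real.norm_eq_abs, abs_of_pos (Real.exp_pos _), Real.exp_le_one_iff]
      have : 0 ≤ 2 * |t| * n := by positivity
      linarith
    have hq' : ‖(n : ℂ) + 1 / 4‖ = (n : ℝ) + 1 / 4 := by
      have : ((n : ℂ) + 1 / 4) = (((n : ℝ) + 1 / 4 : ℝ) : ℂ) := by push_cast; ring
      rw [this, Complex.norm_real, Real.norm_eq_abs, abs_of_pos (by positivity)]
    rw [norm_mul, norm_div, norm_mul, hq', show ‖(1 / 4 : ℂ)‖ = 1 / 4 by simp]
    have hpos : 0 < (n : ℝ) + 1 / 8 := by positivity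
    calc ‖(Real.exp (-(2 * |t| * n)) : ℂ)‖ * (1 / 4 / (‖(n : ℂ) + (1 / 2 - I * z) / 2‖ * ((n : ℝ) + 1 / 4)))
        ≤ 1 * (1 / 4 / (((n : ℝ) + 1 / 8) * ((n : ℝ) + 1 / 8))) := by
          gcongr
          linarith
      _ ≤ 16 / ((n : ℝ) + 1) ^ 2 := by
          rw [one_mul, div_le_div_iff₀ (by positivity) (by positivity)]
          nlinarith
  have hco := continuousOn_tsum hcont hsum hbound
  have hat : Tendsto (fun z : ℂ ↦ ∑' n : ℕ, (Real.exp (-(2 * |t| * n)) : ℂ) *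
      (1 / 4 / (((n : ℂ) + (1 / 2 - I * z) / 2) * ((n : ℂ) + 1 / 4)))) (𝓝 0)
      (𝓝 (∑' n : ℕ, (Real.exp (-(2 * |t| * n)) : ℂ) *
        (1 / 4 / (((n : ℂ) + (1 / 2 - I * 0) / 2) * ((n : ℂ) + 1 / 4))))) :=
    (hco.continuousAt (Metric.isOpen_ball.mem_nhds
      (Metric.mem_ball_self (by norm_num : (0 : ℝ) < 1 / 4)))).tendsto
  have h0 : (∑' n : ℕ, (Real.exp (-(2 * |t| * n)) : ℂ) *
        (1 / 4 / (((n : ℂ) + (1 / 2 - I * 0) / 2) * ((n : ℂ) + 1 / 4)))) =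
      ∑' n : ℕ, (Real.exp (-(2 * |t| * n)) : ℂ) * (1 / 4 / (((n : ℂ) + 1 / 4) * ((n : ℂ) + 1 / 4))) :=
    tsum_congr fun n ↦ by rw [mul_zero, sub_zero, show ((1 : ℂ) / 2) / 2 = 1 / 4 by norm_num]
  rw [h0] at hat
  have hmain := (hat.mono_left (nhdsWithin_le_nhds (s := ({0}ᶜ : Set ℂ)))).const_mul
    (((Real.exp (-(|t| / 2)) : ℝ) : ℂ))
  refine hmain.congr' ?_
  have hball : ({0}ᶜ : Set ℂ) ∩ Metric.ball (0 : ℂ) (1 / 2) ∈ 𝓝[≠] (0 : ℂ) :=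
    inter_mem_nhdsWithin _ (Metric.isOpen_ball.mem_nhds
      (Metric.mem_ball_self (by norm_num : (0 : ℝ) < 1 / 2)))
  filter_upwards [hball] with z hz
  rw [Set.mem_inter_iff, Metric.mem_ball, dist_zero_right] at hz
  have hz0 : z ≠ 0 := hz.1
  unfold screwLerchBracket
  rw [show 1 / (2 * I * z) * ((Real.exp (-(|t| / 2)) : ℝ) : ℂ) *
      (∑' n : ℕ, (Real.exp (-(2 * |t| * n)) : ℂ) *
        (1 / ((n : ℂ) + (1 / 2 - I * z) / 2) - 1 / ((n : ℂ) + 1 / 4))) =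
      ((Real.exp (-(|t| / 2)) : ℝ) : ℂ) *
      ((∑' n : ℕ, (Real.exp (-(2 * |t| * n)) : ℂ) *
        (1 / ((n : ℂ) + (1 / 2 - I * z) / 2) - 1 / ((n : ℂ) + 1 / 4))) * (1 / (2 * I * z))) by ring,
    ← tsum_mul_right]
  congr 1
  exact tsum_congr fun n ↦ (lerchTerm_div_eq t hz0 hz.2 n).symm

end ScrewValueAtZero

open ScrewValueAtZero in
/-- **CJM Thm 7.1, (7.1)** (RH-FREE): `lim_{z→0} 𝔓_t(z) = −g_ξ(t) = Ψ(t) = zetaScrew t` for every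
real `t` — the first conjunct of `Suzuki2025_thm71`, i.e. the value of the meromorphic function
`𝔓_t` at its regular point `0 ∉ Γ`, "obtained by taking the limit `z → 0` in (1.6)". Inputs as
printed: `ψ₁(¼) = Φ(1,2,¼)` (`deriv_digamma_one_quarter`), Gauss's `ψ(¼)`, and
`ζ′/ζ(½) = ½(γ₀ + 3log 2 + log π + π/2)` from `ξ′(½) = 0` (`logDeriv_zeta_one_half`).
[cite: Suzuki2025WeilHilbertSpace, Thm. 7.1 (7.1) (TeX l.2114–2120, proof l.2131–2226)] -/
theorem Suzuki2025_thm71_eq71 (t : ℝ) :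
    Tendsto (screwP t) (𝓝[≠] 0) (𝓝 (zetaScrew t : ℂ)) := by
  -- the limit, term by term
  have h1 := tendsto_const_div_add (4 * ((Real.exp (|t| / 2) - 1 : ℝ) : ℂ))
  have h2 := tendsto_const_div_sub (4 * ((Real.exp (-(|t| / 2)) - 1 : ℝ) : ℂ))
  have h3 := (tendsto_expFactor |t|).mul tendsto_logDerivZeta
  have h4 : Tendsto (fun z : ℂ ↦ ∑ n ∈ Finset.Icc 1 ⌊Real.exp |t|⌋₊,
      ((ArithmeticFunction.vonMangoldt n / Real.sqrt n : ℝ) : ℂ) *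
        ((cexp (-(I * z * ((|t| - Real.log n : ℝ) : ℂ))) - 1) / (I * z))) (𝓝[≠] 0)
      (𝓝 (∑ n ∈ Finset.Icc 1 ⌊Real.exp |t|⌋₊,
        ((ArithmeticFunction.vonMangoldt n / Real.sqrt n : ℝ) : ℂ) * (-((|t| - Real.log n : ℝ) : ℂ)))) :=
    tendsto_finsetSum _ fun n _ ↦ (tendsto_expFactor (|t| - Real.log n)).const_mul _
  have h5 := tendsto_digammaTerm
  have h6 := tendsto_lerchTerm t
  have hall := ((((h1.add h2).add h3).add h4).sub h5).sub h6
  -- the value of the limit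
  have hT6 : (∑' n : ℕ, (Real.exp (-(2 * |t| * n)) : ℂ) * (1 / 4 / (((n : ℂ) + 1 / 4) * ((n : ℂ) + 1 / 4)))) =
      (((1 / 4) * ∑' k : ℕ, Real.exp (-(2 * |t| * k)) / ((k : ℝ) + 1 / 4) ^ 2 : ℝ) : ℂ) := by
    rw [Complex.ofReal_mul, Complex.ofReal_tsum, ← tsum_mul_left]
    refine tsum_congr fun n ↦ ?_
    have hq : ((n : ℂ) + 1 / 4) ≠ 0 := by
      intro h; have := congrArg Complex.re h; simp at this; linarith [n.cast_nonneg (α := ℝ)]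
    push_cast
    field_simp
  have key : ∃ L : ℂ, Tendsto (screwP t) (𝓝[≠] 0) (𝓝 L) ∧ L = (zetaScrew t : ℂ) := by
    refine ⟨_, hall, ?_⟩
    rw [logDeriv_zeta_one_half, deriv_digamma_one_quarter, hT6, zetaScrew_def]
    push_cast
    simp only [mul_neg, Finset.sum_neg_distrib]
    ring
  obtain ⟨L, hL, hLval⟩ := key
  rw [hLval] at hL
  exact hL


end Literature.NumberTheory.LFunctions

end
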